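import Literature.NumberTheory.EllipticCurves.DeShalit1987.LMeasureExistence
import HarnessLib

/-!
# Line `katz_measure_two` — the LANE'S ENDPOINT under planner ruling R3 (bsd-print-cf2-plan g22, 2026-08-30T02:27:22Z), AS A TYPE
# (LEAD bsd-line-cf2-p1 g17; companion of `Lines/katz_measure_two.lean`; NOT a registered stub of 24720 — it does not compose to the leaf under R1)

R3 VERBATIM: «ONE landed Theses-free theorem «the two-variable measure on Γ_K at p = 2 with ALL (m, 0)-identities, m ≥ 3, for K imaginary quadratic with
h_K = 1 (hence K = ℚ(√−7) in use), periods (Ω, δ, Ω₂) as DATA» = de Shalit II.4.14 restricted to (j = 0, m ≥ 3, h_K = 1) — stated INLINE over the existing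
predicates' clauses (no 'IsLMeasure₀' definition items …), filed '--supports stmt-BirchSwinnertonDyer-24720 --as helper'» — banked afterwards as the route-C aside
`KatzDistributionsAtTwoJZeroClassOne`; PARTIAL-DISCHARGE EVIDENCE of the print leaf 24720, not a closer (R1: 24720 stays as typed, full range 0 ≤ j < m).

THIS FILE fixes that endpoint as ONE Lean statement so that the construction widths (cf2c-w4, cf2c-w7, -w2, -w5, -w7, -w8) and the typer converge on the same
type: `lMeasureJZero_classNumberOne_two` below = `DeShalit1987.thmII414_exists_lMeasure` READ AT `p = 2`, with (i) `NumberField.classNumber K = 1` added,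
(ii) the range clause of `DeShalit1987.IsLMeasure` INLINED at `j = 0` with `3 ≤ m` (type `(−m, 0)`, value `interpolationValue 2 v v̄ S ε m 0 Ω δ L(ε,0) · Ω₂^m`;
`(2π/δ)^0 = 1`, so `δ` is idle here and kept only for shape-compatibility with the leaf). Everything else — tower of OPEN subgroups, `⋂ U_n ⊆ rayKer K 2 S`,
`‖μ‖ ≤ 1`, relative avatars `IsPAdicAvatarOutside S`, tower-continuity, entire continuation — is the leaf's clause verbatim.

ON «PERIODS AS DATA» (two readings, both served): (A) the ∃-form below EXHIBITS (Ω, δ, Ω₂) — this is the only closed statement available before R4's objects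
(E = 49a1/K, ω, Ê ≅ `LubinTate.ltF`, Ω₂ = the unit of Ê ≅ 𝔾̂_m over R₀) have tree names; it is TRUE (de Shalit) and is exactly what the lane's chain proves
(the proof constructs Ω from the lattice `Ω·ιK(𝔣)` of (E, ω) and Ω₂ = `coeff 1 ϑ` of the comparison series); (B) once R4 (i) lands, a SHARPER twin
`lMeasureJZero_classNumberOne_two_of_periods` should name Ω, Ω₂ from (E, ω) in its hypotheses and conclude the same body WITHOUT the leading `∃ Ω δ Ωp` —
that twin (not this ∃-form) is the one a later «j = 0 / j > 0» split may use as an antecedent (LEAD memo `LEAD-MEMO-KATZ-RANGE-g17.md` §3: the (m,0) data alone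
pin Ω₂ only up to κ_v(I_v)). Per R5 nobody starts ideal rigidity at j = 0 before this lands.

lean: rc 0 expected, sorries = 1 (the endpoint itself; a TYPE, to be proved by the lane in `Theorems/`, e.g. target
`Theorems/PrintCf2RubinValueTwoKatzMeasureJZeroClassOne.lean`, `--supports stmt-BirchSwinnertonDyer-24720 --as helper`).
No summit statement is proved by this seat; 24720 / 20368 NOT closed; BSD is not proved by any of this.

References: [deShalit1987] II Thm. 4.14 (36) at j = 0 (p. 71), II.4.12 + Remarks (p. 66–67), II.4.16 (49)–(50) (p. 76–77), II.4.17 (p. 77–78).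
-/

set_option autoImplicit false
set_option linter.dupNamespace false

noncomputable section

open scoped Classical
open NumberField IsDedekindDomain Field
open Literature.NumberTheory.GaloisRepresentations Literature.NumberTheory.EllipticCurves
open Literature.NumberTheory.EllipticCurves.DeShalit1987

namespace Summit.BirchSwinnertonDyer.BirchSwinnertonDyer.Cruxes.KatzDistributionsAtTwoPrint.KatzMeasureTwo

/-- **R3 ENDPOINT (type only; planner g22 ruling 2026-08-30T02:27:22Z) — de Shalit II Thm. 4.14 at the split prime `2`, RESTRICTED TO `j = 0`, `m ≥ 3`,
`h_K = 1`, in measure currency on `Γ_K`.** For `K` imaginary quadratic of class number one with `2 = v v̄` split and `v` induced by `ι : ℚ̄₂ ≃ ℂ`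
(so `K = ℚ(√−7)`), there are periods `Ω ≠ 0`, `δ` (`δ² = ±d_K`, idle at `j = 0`), `Ω₂ ∈ R₀ˣ` such that for every finite `S ∌ v, v̄` there is a tower `𝒰`
of open subgroups of `Γ_K` with `⋂ U_n ⊆ rayKer K 2 S` and an integral bounded distribution `μ` along it such that for every Hecke character `ε` of type
`(−m, 0)`, `3 ≤ m`, unramified outside `S ∪ {v̄}`, every `2`-adic avatar `e` of `ε` outside `S` that is tower-continuous, and every entire continuation of
`L(ε, s)`: `∫_{Γ_K} e dμ = ι⁻¹(interpolationValue 2 v v̄ S ε m 0 Ω δ L(ε,0)) · Ω₂^m` — the `(j, m) = (0, ≥ 3)` instances of the clause of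
`DeShalit1987.IsLMeasure ι v v̄ S Ω δ Ω₂ 𝒰 μ`, inlined. The measure lane proves this (elliptic units → relative Coleman series → one-`𝔓` measure → `Γ_K`
measure → glue across moduli → moments = Coates–Wiles values → CM bridge II.4.9 (R4: E = 49a1/K, F = K(𝔪)) → Eisenstein numbers → II.3.5 (13) at
`j = 0`, `k ≥ 3` (-w7 g13 p756189/p756483) → (38)); PARTIAL-DISCHARGE EVIDENCE of the print leaf 24720, not a closer.
[cite: deShalit1987, II Thm. 4.14 (36) (p. 71), II.4.12 with Remarks (i), (iii), (iv) (p. 66–67), II.4.16 (49)–(50) (p. 76–77), II.4.17 (p. 77–78)] -/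
theorem lMeasureJZero_classNumberOne_two :
    ∀ (K : Type) [Field K] [NumberField K], IsImaginaryQuadratic K → NumberField.classNumber K = 1 →
      ∀ (ι : PadicAlgCl 2 ≃+* ℂ) (v vbar : HeightOneSpectrum (𝓞 K)),
        ((2 : ℕ) : 𝓞 K) ∈ v.asIdeal → ((2 : ℕ) : 𝓞 K) ∈ vbar.asIdeal → vbar ≠ v →
        (∀ (w : InfinitePlace K) (k : 𝓞 K), k ∈ v.asIdeal ↔ ‖ι.symm (w.embedding (k : K))‖ < 1) →
      ∃ (Ω δ : ℂ) (Ωp : (unrIntegers 2)ˣ), Ω ≠ 0 ∧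
        (δ ^ 2 = (NumberField.discr K : ℂ) ∨ δ ^ 2 = -(NumberField.discr K : ℂ)) ∧
        ∀ (S : Finset (HeightOneSpectrum (𝓞 K))), v ∉ S → vbar ∉ S →
          ∃ (𝒰 : SubgroupTower (absoluteGaloisGroup K)) (μ : GroupDistribution 𝒰 ℂ_[2]),
            (∀ n, IsOpen (𝒰.U n : Set (absoluteGaloisGroup K))) ∧
            (⋂ n, (𝒰.U n : Set (absoluteGaloisGroup K))) ⊆ DeShalit1987.rayKer K 2 S ∧
            μ.bound ≤ 1 ∧
            ∀ (ε : HeckeCharacter K) (e : FramedGaloisRep K (PadicAlgCl 2) 1) (m : ℕ),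
              IsPAdicAvatarOutside S ι ε e → 3 ≤ m →
              ε.HasInfinityType (fun _ ↦ -(m : ℤ)) (fun _ ↦ ((0 : ℕ) : ℤ)) →
              (∀ w : HeightOneSpectrum (𝓞 K), w ∉ S → w ≠ vbar → ε.IsUnramifiedAt w) →
              𝒰.IsTowerContinuous (fun σ ↦ avatarValueAt e σ) →
              ∀ hL : LFunction.HasEntireContinuation (heckeLFunction ε),
                μ.integral (fun σ ↦ avatarValueAt e σ) =
                  ((ι.symm (DeShalit1987.interpolationValue 2 v vbar S ε m 0 Ω δ (hL.continuation 0)) :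
                      PadicAlgCl 2) : ℂ_[2]) * ((Ωp : unrIntegers 2) : ℂ_[2]) ^ (m + 0) := by
  sorry

/-- **Sanity of the inlining: the full stub gives the R3 endpoint on the nose** (`IsLMeasure` instantiated at `j := 0`; the class-number hypothesis and
`3 ≤ m` are simply not used) — so when the leaf's print is admitted the aside follows, and conversely the endpoint is LITERALLY the `(0, ≥ 3)`-slice of the
leaf's clause (no drift between the two texts). [cite: deShalit1987, II Thm. 4.14 (36) (p. 71), II.4.16 (49)–(50) (p. 76–77)] -/
theorem lMeasureJZero_classNumberOne_two_of_lMeasure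
    (h : ∀ (K : Type) [Field K] [NumberField K], IsImaginaryQuadratic K →
      ∀ (ι : PadicAlgCl 2 ≃+* ℂ) (v vbar : HeightOneSpectrum (𝓞 K)),
        ((2 : ℕ) : 𝓞 K) ∈ v.asIdeal → ((2 : ℕ) : 𝓞 K) ∈ vbar.asIdeal → vbar ≠ v →
        (∀ (w : InfinitePlace K) (k : 𝓞 K), k ∈ v.asIdeal ↔ ‖ι.symm (w.embedding (k : K))‖ < 1) →
      ∃ (Ω δ : ℂ) (Ωp : (unrIntegers 2)ˣ), Ω ≠ 0 ∧
        (δ ^ 2 = (NumberField.discr K : ℂ) ∨ δ ^ 2 = -(NumberField.discr K : ℂ)) ∧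
        ∀ (S : Finset (HeightOneSpectrum (𝓞 K))), v ∉ S → vbar ∉ S →
          ∃ (𝒰 : SubgroupTower (absoluteGaloisGroup K)) (μ : GroupDistribution 𝒰 ℂ_[2]),
            (∀ n, IsOpen (𝒰.U n : Set (absoluteGaloisGroup K))) ∧
            (⋂ n, (𝒰.U n : Set (absoluteGaloisGroup K))) ⊆ DeShalit1987.rayKer K 2 S ∧
            μ.bound ≤ 1 ∧
            DeShalit1987.IsLMeasure ι v vbar S Ω δ ((Ωp : unrIntegers 2) : ℂ_[2]) 𝒰 μ) :
    ∀ (K : Type) [Field K] [NumberField K], IsImaginaryQuadratic K → NumberField.classNumber K = 1 →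
      ∀ (ι : PadicAlgCl 2 ≃+* ℂ) (v vbar : HeightOneSpectrum (𝓞 K)),
        ((2 : ℕ) : 𝓞 K) ∈ v.asIdeal → ((2 : ℕ) : 𝓞 K) ∈ vbar.asIdeal → vbar ≠ v →
        (∀ (w : InfinitePlace K) (k : 𝓞 K), k ∈ v.asIdeal ↔ ‖ι.symm (w.embedding (k : K))‖ < 1) →
      ∃ (Ω δ : ℂ) (Ωp : (unrIntegers 2)ˣ), Ω ≠ 0 ∧
        (δ ^ 2 = (NumberField.discr K : ℂ) ∨ δ ^ 2 = -(NumberField.discr K : ℂ)) ∧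
        ∀ (S : Finset (HeightOneSpectrum (𝓞 K))), v ∉ S → vbar ∉ S →
          ∃ (𝒰 : SubgroupTower (absoluteGaloisGroup K)) (μ : GroupDistribution 𝒰 ℂ_[2]),
            (∀ n, IsOpen (𝒰.U n : Set (absoluteGaloisGroup K))) ∧
            (⋂ n, (𝒰.U n : Set (absoluteGaloisGroup K))) ⊆ DeShalit1987.rayKer K 2 S ∧
            μ.bound ≤ 1 ∧
            ∀ (ε : HeckeCharacter K) (e : FramedGaloisRep K (PadicAlgCl 2) 1) (m : ℕ),
              IsPAdicAvatarOutside S ι ε e → 3 ≤ m →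
              ε.HasInfinityType (fun _ ↦ -(m : ℤ)) (fun _ ↦ ((0 : ℕ) : ℤ)) →
              (∀ w : HeightOneSpectrum (𝓞 K), w ∉ S → w ≠ vbar → ε.IsUnramifiedAt w) →
              𝒰.IsTowerContinuous (fun σ ↦ avatarValueAt e σ) →
              ∀ hL : LFunction.HasEntireContinuation (heckeLFunction ε),
                μ.integral (fun σ ↦ avatarValueAt e σ) =
                  ((ι.symm (DeShalit1987.interpolationValue 2 v vbar S ε m 0 Ω δ (hL.continuation 0)) :
                      PadicAlgCl 2) : ℂ_[2]) * ((Ωp : unrIntegers 2) : ℂ_[2]) ^ (m + 0) := by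
  intro K _ _ hK _ ι v vbar hv hvbar hne hι
  obtain ⟨Ω, δ, Ωp, hΩ, hδ, hall⟩ := h K hK ι v vbar hv hvbar hne hι
  refine ⟨Ω, δ, Ωp, hΩ, hδ, fun S hvS hvbarS ↦ ?_⟩
  obtain ⟨𝒰, μ, hopen, hray, hbd, hL⟩ := hall S hvS hvbarS
  refine ⟨𝒰, μ, hopen, hray, hbd, fun ε e m he hm hinf hunr hcont hLc ↦ ?_⟩
  exact hL ε e m 0 he (lt_of_lt_of_le (by norm_num) hm) hinf hunr hcont hLc

end Summit.BirchSwinnertonDyer.BirchSwinnertonDyer.Cruxes.KatzDistributionsAtTwoPrint.KatzMeasureTwo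

end
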